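import Literature.NumberTheory.Automorphic.PairLFunctionPolesChangeOfS
import HarnessLib

/-!
# Arthur–Clozel (2.2) at `s = 1`, `π ≇ σ̃`: change of the finite set `S` and the one-family form

Topic `NumberTheory/Automorphic`; namespace `Literature.NumberTheory.Automorphic`. Proof file
(theorems only: no definition, no named fact, no instance) under the named fact
`JacquetShalika1981_partialPairL_at_one_of_ne_conj` of `PairLFunctionPoles` — Arthur–Clozel,
*Simple algebras, base change, and the advanced theory of the trace formula*, Ann. of Math.
Stud. 120 (1989), Ch. 3 §2, (2.2), p. 171 of the held copy, at `s₀ = 1` for unitary cuspidal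
`π ≇ σ̃` on `GL_n(𝔸_K)`: for **every** finite set `S` of finite places off which `π`, `σ` are
unramified and **every** pair of Satake families `α`, `β` of `π`, `σ` off `S`,
`L^S(s, π ⊗ σ) = partialPairL S α β s` has a finite non-zero limit as `s → 1`, `Re s > 1`.

This is the companion, for equal ranks and `π ≇ σ̃` (`P ≠ P'.conj` under multiplicity one), of
`PairLFunctionPolesChangeOfS` (the case `n ≠ m`,
`JacquetShalika1981_partialPairL_at_one_of_rank_ne_of_one_family`), whose bookkeeping it reuses
verbatim: the printed sources prove (2.2) for **one** finite set of places "large enough"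
(Jacquet–Shalika (1981), (5.1), p. 554; Cogdell (2004), §4.1) and the canonical Satake classes;
passing to an arbitrary admissible `S` moves finitely many unramified Euler factors
`L_v(s) = det(1 - A_v ⊗ B_v q_v^{-s})⁻¹`, continuous and non-zero at `s₀ = 1` because no product
`a b` of Satake parameters equals `q_v` — Jacquet–Shalika's **strict** bound `|a| < q_v^{1/2}`
(loc. cit. Cor. (2.5), p. 515), `eval_satakePairPolynomial_ne_zero_of_lt_sqrt`.

* `JacquetShalika1981_partialPairL_at_one_of_ne_conj_of_one_family` (**main**) — the named fact
  from: (2.1) `JacquetShalika1981_multipliable_partialPairL` at `(n, n)`, the strict bound for the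
  Satake families of cuspidal representations of `GL_n(𝔸_K)`, and **one** datum per pair
  `(π, σ)` with `π ≠ σ̄`: a finite `S₀`, Satake families `α₀`, `β₀` off `S₀` and a finite non-zero
  limit of `L^{S₀}(s, α₀ ⊗ β₀)` at `1` from `Re s > 1` (what Jacquet–Shalika II, Prop. 3.6 with
  Shahidi (1980) deliver);
* `JacquetShalika1981_partialPairL_at_one_of_ne_conj_iff_one_family` — tightness: under the same
  standing inputs the fact is *equivalent* to its one-family form;
* `JacquetShalika1981_partialPairL_at_one_of_ne_conj_of_one_family_of_isGeneric` — the strict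
  bound fed from the named facts (A) genericity, (B) Jacquet–Shalika's Cor. (2.5), (C) Flath's
  dictionary (`norm_satakeParameter_lt_sqrt_of_isGeneric` of `PairLFunctionPolesChangeOfS`).

## References

* J. Arthur, L. Clozel, *Simple algebras, base change, and the advanced theory of the trace
  formula*, Ann. of Math. Stud. 120 (1989), Ch. 3 §2, (2.1)–(2.2), p. 171. [ArthurClozelAMS120]
* H. Jacquet, J. A. Shalika, *On Euler products and the classification of automorphic
  representations I*, Amer. J. Math. 103 (1981), 499–558: Cor. (2.5) p. 515, (5.1) p. 554,
  Thm. (5.3). [JacquetShalikaAJM1981]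
* F. Shahidi, *On nonvanishing of `L`-functions*, Bull. Amer. Math. Soc. (N.S.) 2 (1980), 462–464,
  Theorem p. 462. [ShahidiBAMS1980]
-/

noncomputable section

open scoped MatrixGroups Topology
open NumberField IsDedekindDomain MeasureTheory Filter Polynomial Complex

namespace Literature.NumberTheory.Automorphic

open AdelicGroupData

section OneFamily

variable {n : ℕ} {K : Type} [Field K] [NumberField K]
  {μ : Measure (gl n K).automorphicQuotient} [(gl n K).IsAutomorphicMeasure μ]

/-- **Arthur–Clozel (2.2) at `s = 1`, `π ≇ σ̃`, from its one-family form.** Standing inputs,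
all statements of the tree: (2.1) `JacquetShalika1981_multipliable_partialPairL` at `(n, n)`
(Jacquet–Shalika (1981), Thm. (5.3)); the strict bound `|a| < q_v^{1/2}` for the Satake families
of cuspidal representations of `GL_n(𝔸_K)` (loc. cit. Cor. (2.5);
`norm_satakeParameter_lt_sqrt_of_isGeneric` derives it from the named facts of
`SatakeParameterGenericBound`). Then the named fact
`JacquetShalika1981_partialPairL_at_one_of_ne_conj` — for **all** finite `S` and **all** Satake
families off `S` — follows from **one** datum per pair `(π, σ)` with `π ≠ σ̄`, `n ≥ 1` (under
multiplicity one): a finite `S₀`, Satake families `α₀`, `β₀` of `π`, `σ` off `S₀`, and a finite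
non-zero limit of `L^{S₀}(s, α₀ ⊗ β₀)` at `1` from `Re s > 1` (what Jacquet–Shalika II, Prop. 3.6
with Shahidi (1980) deliver for `S` "large enough" and the canonical classes). Proof: transfer
up `S₀ ↑ S ∪ S₀`, `L^{S ∪ S₀}(α ⊗ β) = L^{S ∪ S₀}(α₀ ⊗ β₀)` (uniqueness of Hecke–Satake
parameters), transfer down `S ∪ S₀ ↓ S`; the factors moved are unramified for both `π` and `σ`,
so `det(1 - A_v ⊗ B_v q_v^{-1}) ≠ 0` by `eval_satakePairPolynomial_ne_zero_of_lt_sqrt`.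
[cite: ArthurClozelAMS120, Ch. 3 §2 (2.2)] -/
theorem JacquetShalika1981_partialPairL_at_one_of_ne_conj_of_one_family
    (h21 : JacquetShalika1981_multipliable_partialPairL (n := n) (m := n) (K := K) (μ := μ)
      (μ' := μ))
    (hlt : ∀ (P : CuspidalAutomorphicRepGL n K μ) {S : Set (HeightOneSpectrum (𝓞 K))}
      {α : SatakeFamily K} (_hα : IsSatakeFamilyOf P S α) {v : HeightOneSpectrum (𝓞 K)}
      (_hv : v ∉ S) {a : ℂ} (_ha : a ∈ α v), ‖a‖ < Real.sqrt v.residueCard)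
    (hone : ∀ (_hn : 0 < n) (_h₁ : multiplicity_one_gl n K μ)
      (P P' : CuspidalAutomorphicRepGL n K μ) (_hne : P ≠ P'.conj),
      ∃ (S₀ : Set (HeightOneSpectrum (𝓞 K))) (α₀ β₀ : SatakeFamily K), S₀.Finite ∧
        IsSatakeFamilyOf P S₀ α₀ ∧ IsSatakeFamilyOf P' S₀ β₀ ∧
        ∃ c : ℂ, c ≠ 0 ∧ Tendsto (partialPairL S₀ α₀ β₀) (𝓝[{s : ℂ | 1 < s.re}] 1) (𝓝 c)) :
    JacquetShalika1981_partialPairL_at_one_of_ne_conj (n := n) (K := K) (μ := μ) := by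
  intro hn h₁ P P' hPP' S hS α β hα hβ
  obtain ⟨S₀, α₀, β₀, hS₀, hα₀, hβ₀, hlim⟩ := hone hn h₁ P P' hPP'
  -- non-vanishing of an unramified factor at `s₀ = 1`
  have hne : ∀ {T : Set (HeightOneSpectrum (𝓞 K))} {γ δ : SatakeFamily K}
      (_hγ : IsSatakeFamilyOf P T γ) (_hδ : IsSatakeFamilyOf P' T δ) {v : HeightOneSpectrum (𝓞 K)}
      (_hv : v ∉ T),
      (satakePairPolynomial (γ v) (δ v)).eval ((v.residueCard : ℂ) ^ (-(1 : ℂ))) ≠ 0 :=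
    fun hγ hδ v hv => eval_satakePairPolynomial_ne_zero_of_lt_sqrt v.one_lt_residueCard
      (fun a ha => hlt P hγ hv ha) (fun b hb => (hlt P' hδ hv hb).le) Complex.one_re
  have hT : ((S ∪ S₀) \ S₀).Finite := (hS.union hS₀).subset fun v hv => hv.1
  have hT' : ((S ∪ S₀) \ S).Finite := (hS.union hS₀).subset fun v hv => hv.1
  -- up from `S₀` to `S ∪ S₀` with the families `α₀`, `β₀`
  have h1 : ∃ c : ℂ, c ≠ 0 ∧
      Tendsto (partialPairL (S ∪ S₀) α₀ β₀) (𝓝[{s : ℂ | 1 < s.re}] 1) (𝓝 c) :=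
    exists_ne_zero_tendsto_partialPairL_of_supset Set.subset_union_right hT
      (eventually_multipliable_of_multipliable_partialPairL h21 Set.subset_union_right hα₀ hβ₀ 1)
      (fun v hv => hne hα₀ hβ₀ hv.2) hlim
  -- `α = α₀`, `β = β₀` off `S ∪ S₀`
  rw [← partialPairL_eq_of_isSatakeFamilyOf Set.subset_union_left Set.subset_union_right hα hβ
    hα₀ hβ₀] at h1
  -- down from `S ∪ S₀` to `S` with the families `α`, `β`
  exact exists_ne_zero_tendsto_partialPairL_of_subset Set.subset_union_left hT'
    (eventually_multipliable_of_multipliable_partialPairL h21 Set.subset_union_left hα hβ 1)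
    (fun v hv => hne hα hβ hv.2) h1

/-- **Tightness.** Conversely the named fact gives the one-family datum for every pair (take the
finite sets of ramified places and Satake families provided by the discharged
`exists_isSatakeFamilyOf_holds`, and their union), so under the standing inputs of
`JacquetShalika1981_partialPairL_at_one_of_ne_conj_of_one_family` the fact is *equivalent* to
its one-family form: the reduction neither loses nor adds strength. [folklore] -/
theorem JacquetShalika1981_partialPairL_at_one_of_ne_conj_iff_one_family
    (h21 : JacquetShalika1981_multipliable_partialPairL (n := n) (m := n) (K := K) (μ := μ)
      (μ' := μ))
    (hlt : ∀ (P : CuspidalAutomorphicRepGL n K μ) {S : Set (HeightOneSpectrum (𝓞 K))}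
      {α : SatakeFamily K} (_hα : IsSatakeFamilyOf P S α) {v : HeightOneSpectrum (𝓞 K)}
      (_hv : v ∉ S) {a : ℂ} (_ha : a ∈ α v), ‖a‖ < Real.sqrt v.residueCard) :
    JacquetShalika1981_partialPairL_at_one_of_ne_conj (n := n) (K := K) (μ := μ) ↔
      ∀ (_hn : 0 < n) (_h₁ : multiplicity_one_gl n K μ)
        (P P' : CuspidalAutomorphicRepGL n K μ) (_hne : P ≠ P'.conj),
        ∃ (S₀ : Set (HeightOneSpectrum (𝓞 K))) (α₀ β₀ : SatakeFamily K), S₀.Finite ∧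
          IsSatakeFamilyOf P S₀ α₀ ∧ IsSatakeFamilyOf P' S₀ β₀ ∧
          ∃ c : ℂ, c ≠ 0 ∧ Tendsto (partialPairL S₀ α₀ β₀) (𝓝[{s : ℂ | 1 < s.re}] 1) (𝓝 c) := by
  refine ⟨fun h hn h₁ P P' hPP' => ?_,
    JacquetShalika1981_partialPairL_at_one_of_ne_conj_of_one_family h21 hlt⟩
  obtain ⟨S₁, α₀, -, hα₀⟩ := exists_isSatakeFamilyOf_holds (n := n) (K := K) (μ := μ) P
  obtain ⟨S₂, β₀, -, hβ₀⟩ := exists_isSatakeFamilyOf_holds (n := n) (K := K) (μ := μ) P'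
  have hfin : ((↑S₁ : Set (HeightOneSpectrum (𝓞 K))) ∪ ↑S₂).Finite :=
    (S₁.finite_toSet).union S₂.finite_toSet
  exact ⟨↑S₁ ∪ ↑S₂, α₀, β₀, hfin, hα₀.mono Set.subset_union_left, hβ₀.mono Set.subset_union_right,
    h hn h₁ P P' hPP' hfin (hα₀.mono Set.subset_union_left) (hβ₀.mono Set.subset_union_right)⟩

/-- **The named fact from its one-family form and the printed named inputs.** As
`JacquetShalika1981_partialPairL_at_one_of_ne_conj_of_one_family`, with the strict bound at
`GL_n` fed from the named facts of `SatakeParameterGenericBound` — existence of local components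
(`exists_hasLocalComponentAt`), Flath's dictionary
(`Flath1979_isSatakeParameter_of_hasLocalComponentAt`), genericity
(`Shalika1974_isGeneric_of_hasLocalComponentAt`), Jacquet–Shalika's Cor. (2.5)
(`JacquetShalika1981_norm_lt_sqrt_of_isGeneric`) — through
`norm_satakeParameter_lt_sqrt_of_isGeneric`. What then remains for
`JacquetShalika1981_partialPairL_at_one_of_ne_conj_holds` is these named inputs, (2.1), and the
one-family datum (Jacquet–Shalika II, Prop. 3.6 + Shahidi (1980) for one large `S`).
[cite: ArthurClozelAMS120, Ch. 3 §2 (2.2)] -/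
theorem JacquetShalika1981_partialPairL_at_one_of_ne_conj_of_one_family_of_isGeneric
    (h21 : JacquetShalika1981_multipliable_partialPairL (n := n) (m := n) (K := K) (μ := μ)
      (μ' := μ))
    (hF : exists_hasLocalComponentAt (n := n) (K := K) (μ := μ))
    (hC : Flath1979_isSatakeParameter_of_hasLocalComponentAt (n := n) (K := K) (μ := μ))
    (hA : Shalika1974_isGeneric_of_hasLocalComponentAt (n := n) (K := K) (μ := μ))
    (hB : ∀ (v : HeightOneSpectrum (𝓞 K)) {V : Type} [AddCommGroup V] [Module ℂ V]
      (ρ : Representation ℂ (GL (Fin n) (v.adicCompletion K)) V),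
      JacquetShalika1981_norm_lt_sqrt_of_isGeneric ρ)
    (hone : ∀ (_hn : 0 < n) (_h₁ : multiplicity_one_gl n K μ)
      (P P' : CuspidalAutomorphicRepGL n K μ) (_hne : P ≠ P'.conj),
      ∃ (S₀ : Set (HeightOneSpectrum (𝓞 K))) (α₀ β₀ : SatakeFamily K), S₀.Finite ∧
        IsSatakeFamilyOf P S₀ α₀ ∧ IsSatakeFamilyOf P' S₀ β₀ ∧
        ∃ c : ℂ, c ≠ 0 ∧ Tendsto (partialPairL S₀ α₀ β₀) (𝓝[{s : ℂ | 1 < s.re}] 1) (𝓝 c)) :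
    JacquetShalika1981_partialPairL_at_one_of_ne_conj (n := n) (K := K) (μ := μ) :=
  JacquetShalika1981_partialPairL_at_one_of_ne_conj_of_one_family h21
    (fun P _ _ hα _ hv _ ha => norm_satakeParameter_lt_sqrt_of_isGeneric hF hC hA hB P hα hv ha)
    hone

end OneFamily

end Literature.NumberTheory.Automorphic
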